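import Mathlib
import Summits.ValiantsHypothesis.ValiantsHypothesis.Theorems.LiouvilleSarnakCutRankAlignedWindow
import Summits.ValiantsHypothesis.ValiantsHypothesis.Theorems.LiouvilleSarnakLiouvilleCutRankSwapStability

/-!
# Route LiouvilleSarnak — crux `LiouvilleCutRank` (stmt-ValiantsHypothesis-14775):
# DEFECTIVE ALIGNED WINDOWS — a window `R^L C^L` with up to `d` wrong letters forces rank `≥ W`

`Theorems/LiouvilleSarnakCutRankAlignedWindow.lean`: a cut word containing an EXACT aligned window `R^L C^L`
(`L ≥ L₀(W)`) has Liouville cut-matrix rank `≥ W`.  `Theorems/LiouvilleSarnakLiouvilleCutRankSwapStability.lean`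
(this hand): exchanging the roles of one row bit and one column bit costs at most a factor `4` in rank.
This file does the defect PAIRING once and for all and lands the user-facing robust class:

* §1 `foldr_swaps_apply_*` — a swap list with distinct row indices and distinct column indices acts in
  parallel: a swapped pair `(i, j)` exchanges positions, untouched indices keep theirs.
* §2 `window_after_swaps` — if every column index in the first half and every row index in the second half
  is swapped with a partner outside the respective half, the repaired cut has the exact window `R^L C^L`.
* §3 `card_rows_add_card_cols_le` — a half-window of length `L` holds at most `L` indices; hence the rows
  outside the first half are at least as many as the columns inside it (and symmetrically), so partners exist.
* §4 ★ `le_rank_of_defectiveAlignedWindow` — **for all `W, d` there is `L` such that at every level, every cut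
  with a window `[s, s+2L)` carrying `≤ d` wrong letters (column bits in the first half plus row bits in the
  second half) has rank `≥ W`** (`max(d₁,d₂) ≤ d` swaps repair it; `4^d W ≤ rank(repaired) ≤ 4^d rank M_π`).

This contains, qualitatively, `…StrayRows` / `…StrayWindows` (strays at one end), `…SeparatedBlocks` (junk of
bounded length between two long opposite runs) and `…LongRun`, and adds every placement of the defects (e.g.
`R^{L/2} C R^{L/2-1} C^{L-3} R C C`).  The anti-aligned orientation `C^L R^L` follows by exchanging rows and
columns (`Rectangles.cutNumber_swap`, rank of the transpose) and is left to the user.  Honest framing: a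
robust version of the aligned class; the defect budget `d` is FIXED while `L → ∞` (a budget `d = o(L)` would
need quantitative non-automaticity of `λ`); `LiouvilleCutRank`, `DigitalBilinearLiouville`, `AlgebraicSarnak`
stay OPEN; nothing here bears on `VP ≠ VNP`.  No definitions.
-/

set_option linter.dupNamespace false

noncomputable section

namespace Summit.ValiantsHypothesis.ValiantsHypothesis.Theorems.LiouvilleSarnakLiouvilleCutRank.DefectiveWindow

open ArithmeticFunction Finset

open Summit.ValiantsHypothesis.ValiantsHypothesis.Theorems.LiouvilleSarnakCutRankAlignedWindow
  (le_rank_of_alignedWindow)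
open Summit.ValiantsHypothesis.ValiantsHypothesis.Theorems.LiouvilleSarnakLiouvilleCutRank.SwapStability
  (rank_swaps_le)

/-! ### §1 Where the indices go after a list of swaps -/

/-- A row index not touched by the swap list keeps its position. [folklore] -/
theorem foldr_swaps_apply_inl_of_not_mem {n : ℕ} (π : Fin n ⊕ Fin n ≃ Fin (2 * n))
    (Lw : List (Fin n × Fin n)) (i : Fin n) (hi : i ∉ Lw.map Prod.fst) :
    (Lw.foldr (fun q e => (Equiv.swap (Sum.inl q.1) (Sum.inr q.2)).trans e) π) (Sum.inl i) =
      π (Sum.inl i) := by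
  induction Lw with
  | nil => rfl
  | cons q Lw ih =>
    rw [List.map_cons, List.mem_cons, not_or] at hi
    rw [List.foldr_cons, Equiv.trans_apply,
      Equiv.swap_apply_of_ne_of_ne (by simpa using hi.1) (by simp), ih hi.2]

/-- A column index not touched by the swap list keeps its position. [folklore] -/
theorem foldr_swaps_apply_inr_of_not_mem {n : ℕ} (π : Fin n ⊕ Fin n ≃ Fin (2 * n))
    (Lw : List (Fin n × Fin n)) (j : Fin n) (hj : j ∉ Lw.map Prod.snd) :
    (Lw.foldr (fun q e => (Equiv.swap (Sum.inl q.1) (Sum.inr q.2)).trans e) π) (Sum.inr j) =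
      π (Sum.inr j) := by
  induction Lw with
  | nil => rfl
  | cons q Lw ih =>
    rw [List.map_cons, List.mem_cons, not_or] at hj
    rw [List.foldr_cons, Equiv.trans_apply,
      Equiv.swap_apply_of_ne_of_ne (by simp) (by simpa using hj.1), ih hj.2]

/-- A swapped pair exchanges positions (swap lists with distinct row indices and distinct column
indices act "in parallel"). [folklore] -/
theorem foldr_swaps_apply_of_mem {n : ℕ} (π : Fin n ⊕ Fin n ≃ Fin (2 * n))
    (Lw : List (Fin n × Fin n)) (h1 : (Lw.map Prod.fst).Nodup) (h2 : (Lw.map Prod.snd).Nodup)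
    (i j : Fin n) (hij : (i, j) ∈ Lw) :
    (Lw.foldr (fun q e => (Equiv.swap (Sum.inl q.1) (Sum.inr q.2)).trans e) π) (Sum.inl i) =
        π (Sum.inr j) ∧
      (Lw.foldr (fun q e => (Equiv.swap (Sum.inl q.1) (Sum.inr q.2)).trans e) π) (Sum.inr j) =
        π (Sum.inl i) := by
  induction Lw with
  | nil => simp at hij
  | cons q Lw ih =>
    rw [List.map_cons, List.nodup_cons] at h1 h2
    rw [List.foldr_cons, Equiv.trans_apply, Equiv.trans_apply]
    rcases List.mem_cons.mp hij with hq | hmem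
    · -- the head pair
      subst hq
      refine ⟨?_, ?_⟩
      · rw [Equiv.swap_apply_left]
        exact foldr_swaps_apply_inr_of_not_mem π Lw j h2.1
      · rw [Equiv.swap_apply_right]
        exact foldr_swaps_apply_inl_of_not_mem π Lw i h1.1
    · have hi : i ≠ q.1 := fun h => h1.1 (h ▸ List.mem_map.mpr ⟨(i, j), hmem, rfl⟩)
      have hj : j ≠ q.2 := fun h => h2.1 (h ▸ List.mem_map.mpr ⟨(i, j), hmem, rfl⟩)
      rw [Equiv.swap_apply_of_ne_of_ne (by simpa using hi) (by simp),
        Equiv.swap_apply_of_ne_of_ne (by simp) (by simpa using hj)]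
      exact ih h1.2 h2.2 hmem

/-! ### §2 After swapping every defect away, the window is exactly aligned -/

/-- **Repaired window.**  Let `Lw` be a swap list with distinct row indices and distinct column indices such
that every column index sitting in the first half `[s, s+L)` and every row index sitting in the second half
`[s+L, s+2L)` is swapped, while no swapped row index sits in the first half and no swapped column index sits
in the second half.  Then after the swaps the positions `[s, s+L)` are row bits and `[s+L, s+2L)` are column
bits. [folklore] -/
theorem window_after_swaps {n : ℕ} (π : Fin n ⊕ Fin n ≃ Fin (2 * n)) (Lw : List (Fin n × Fin n))
    (h1 : (Lw.map Prod.fst).Nodup) (h2 : (Lw.map Prod.snd).Nodup) (s L : ℕ)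
    (hA : ∀ j : Fin n, s ≤ (π (Sum.inr j) : ℕ) → (π (Sum.inr j) : ℕ) < s + L → j ∈ Lw.map Prod.snd)
    (hB : ∀ i : Fin n, s + L ≤ (π (Sum.inl i) : ℕ) → (π (Sum.inl i) : ℕ) < s + 2 * L →
      i ∈ Lw.map Prod.fst)
    (hR : ∀ q ∈ Lw, ¬ (s ≤ (π (Sum.inl q.1) : ℕ) ∧ (π (Sum.inl q.1) : ℕ) < s + L))
    (hC : ∀ q ∈ Lw, ¬ (s + L ≤ (π (Sum.inr q.2) : ℕ) ∧ (π (Sum.inr q.2) : ℕ) < s + 2 * L)) :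
    (∀ k : Fin (2 * n), s ≤ (k : ℕ) → (k : ℕ) < s + L →
      ((Lw.foldr (fun q e => (Equiv.swap (Sum.inl q.1) (Sum.inr q.2)).trans e) π).symm k).isLeft =
        true) ∧
    (∀ k : Fin (2 * n), s + L ≤ (k : ℕ) → (k : ℕ) < s + 2 * L →
      ((Lw.foldr (fun q e => (Equiv.swap (Sum.inl q.1) (Sum.inr q.2)).trans e) π).symm k).isLeft =
        false) := by
  set π₀ := Lw.foldr (fun q e => (Equiv.swap (Sum.inl q.1) (Sum.inr q.2)).trans e) π with hπ₀
  refine ⟨fun k hk1 hk2 => ?_, fun k hk1 hk2 => ?_⟩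
  · rcases hx : π₀.symm k with i | j
    · rfl
    · exfalso
      have hk : π₀ (Sum.inr j) = k := by rw [← hx, Equiv.apply_symm_apply]
      by_cases hj : j ∈ Lw.map Prod.snd
      · obtain ⟨q, hq, hqj⟩ := List.mem_map.mp hj
        have hmem : (q.1, j) ∈ Lw := by rw [← hqj]; exact hq
        have h := (foldr_swaps_apply_of_mem π Lw h1 h2 q.1 j hmem).2
        rw [← hπ₀, hk] at h
        exact hR q hq ⟨by rw [← h]; exact hk1, by rw [← h]; exact hk2⟩
      · have h := foldr_swaps_apply_inr_of_not_mem π Lw j hj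
        rw [← hπ₀, hk] at h
        exact hj (hA j (by rw [← h]; exact hk1) (by rw [← h]; exact hk2))
  · rcases hx : π₀.symm k with i | j
    · exfalso
      have hk : π₀ (Sum.inl i) = k := by rw [← hx, Equiv.apply_symm_apply]
      by_cases hi : i ∈ Lw.map Prod.fst
      · obtain ⟨q, hq, hqi⟩ := List.mem_map.mp hi
        have hmem : (i, q.2) ∈ Lw := by rw [← hqi]; exact hq
        have h := (foldr_swaps_apply_of_mem π Lw h1 h2 i q.2 hmem).1
        rw [← hπ₀, hk] at h
        exact hC q hq ⟨by rw [← h]; exact hk1, by rw [← h]; exact hk2⟩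
      · have h := foldr_swaps_apply_inl_of_not_mem π Lw i hi
        rw [← hπ₀, hk] at h
        exact hi (hB i (by rw [← h]; exact hk1) (by rw [← h]; exact hk2))
    · rfl

/-! ### §3 Counting: enough opposite letters to pair every defect -/

/-- In the window half `[a, a + L)` (inside `[0, 2n)`), the row indices and the column indices sitting
there number at most `L` together. [folklore] -/
theorem card_rows_add_card_cols_le {n : ℕ} (π : Fin n ⊕ Fin n ≃ Fin (2 * n)) (a L : ℕ) :
    (univ.filter fun i : Fin n => a ≤ (π (Sum.inl i) : ℕ) ∧ (π (Sum.inl i) : ℕ) < a + L).card +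
      (univ.filter fun j : Fin n => a ≤ (π (Sum.inr j) : ℕ) ∧ (π (Sum.inr j) : ℕ) < a + L).card ≤ L := by
  classical
  set I := univ.filter fun i : Fin n => a ≤ (π (Sum.inl i) : ℕ) ∧ (π (Sum.inl i) : ℕ) < a + L
  set J := univ.filter fun j : Fin n => a ≤ (π (Sum.inr j) : ℕ) ∧ (π (Sum.inr j) : ℕ) < a + L
  have hcard : (I.disjSum J).card = I.card + J.card := card_disjSum _ _
  rw [← hcard]
  -- inject into `Ico a (a + L)` via `x ↦ π x`
  calc (I.disjSum J).card ≤ (Finset.Ico a (a + L)).card := by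
        refine card_le_card_of_injOn (fun x => (π x : ℕ)) ?_ ?_
        · intro x hx
          rw [mem_coe, mem_disjSum] at hx
          rw [mem_coe, mem_Ico]
          rcases hx with ⟨i, hi, rfl⟩ | ⟨j, hj, rfl⟩
          · exact (mem_filter.mp hi).2
          · exact (mem_filter.mp hj).2
        · intro x _ y _ hxy
          exact π.injective (Fin.ext hxy)
    _ = L := by rw [Nat.card_Ico]; omega

/-! ### §4 Defective aligned windows -/

/-- ★ **`R^L C^L` up to `d` wrong letters.**  For all `W, d` there is `L` such that at every level `n`,
every cut `π` with a window `[s, s+2L)` whose first half carries at most `d₁` column bits and whose second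
half carries at most `d₂` row bits, `d₁ + d₂ ≤ d`, has Liouville cut-matrix rank `≥ W`.  Proof: pair each
first-half column with a second-half row or, when those run out, with a row outside the first half (there
are enough: rows outside the first half number `n − #rows(first half) ≥ #cols(first half)`), and
symmetrically; the `≤ d` swaps produce a cut with the exact window `R^L C^L`
(`window_after_swaps`), of rank `≥ 4^d W` by `CutRankAlignedWindow.le_rank_of_alignedWindow`, and
`SwapStability.rank_swaps_le` divides by `4^d`.  Contains `…StrayWindows`, `…SeparatedBlocks` (junk of
length `j` between `R^a` and `C^b` is `≤ j` defects) and much more (defects anywhere). [this file] -/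
theorem le_rank_of_defectiveAlignedWindow (W d : ℕ) : ∃ L : ℕ, ∀ (n : ℕ)
    (π : Fin n ⊕ Fin n ≃ Fin (2 * n)) (s : ℕ), s + 2 * L ≤ 2 * n →
    (univ.filter fun j : Fin n => s ≤ (π (Sum.inr j) : ℕ) ∧ (π (Sum.inr j) : ℕ) < s + L).card +
      (univ.filter fun i : Fin n =>
        s + L ≤ (π (Sum.inl i) : ℕ) ∧ (π (Sum.inl i) : ℕ) < s + L + L).card ≤ d →
    W ≤ (Matrix.of fun r c : Fin n → Bool =>
      (((liouville (Nat.ofBits (fun k : Fin (2 * n) => Sum.elim r c (π.symm k)) + 1) : ℤ) :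
        ℂ))).rank := by
  classical
  obtain ⟨L, hL⟩ := le_rank_of_alignedWindow (4 ^ d * W)
  refine ⟨L, fun n π s hs hdef => ?_⟩
  -- defects and available partners
  set Jdef := univ.filter fun j : Fin n => s ≤ (π (Sum.inr j) : ℕ) ∧ (π (Sum.inr j) : ℕ) < s + L
    with hJdef
  set Idef := univ.filter fun i : Fin n =>
      s + L ≤ (π (Sum.inl i) : ℕ) ∧ (π (Sum.inl i) : ℕ) < s + L + L with hIdef
  set Rav := univ.filter fun i : Fin n => ¬ (s ≤ (π (Sum.inl i) : ℕ) ∧ (π (Sum.inl i) : ℕ) < s + L)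
    with hRav
  set Cav := univ.filter fun j : Fin n =>
      ¬ (s + L ≤ (π (Sum.inr j) : ℕ) ∧ (π (Sum.inr j) : ℕ) < s + L + L) with hCav
  have hIR : Idef ⊆ Rav := by
    intro i hi
    rw [hIdef, mem_filter] at hi
    rw [hRav, mem_filter]
    exact ⟨mem_univ _, fun h => by omega⟩
  have hJC : Jdef ⊆ Cav := by
    intro j hj
    rw [hJdef, mem_filter] at hj
    rw [hCav, mem_filter]
    exact ⟨mem_univ _, fun h => by omega⟩
  -- counting
  have hL2n : L ≤ n := by omega
  have hc1 := card_rows_add_card_cols_le π s L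
  have hc2 := card_rows_add_card_cols_le π (s + L) L
  have hsplit1 := card_filter_add_card_filter_not
    (s := (univ : Finset (Fin n))) (fun i : Fin n => s ≤ (π (Sum.inl i) : ℕ) ∧ (π (Sum.inl i) : ℕ) < s + L)
  have hsplit2 := card_filter_add_card_filter_not
    (s := (univ : Finset (Fin n)))
    (fun j : Fin n => s + L ≤ (π (Sum.inr j) : ℕ) ∧ (π (Sum.inr j) : ℕ) < s + L + L)
  rw [card_univ, Fintype.card_fin] at hsplit1 hsplit2
  have hRav_card : Jdef.card ≤ Rav.card := by rw [hJdef, hRav]; omega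
  have hCav_card : Idef.card ≤ Cav.card := by rw [hIdef, hCav]; omega
  -- the common size of the pairing
  set m := max Jdef.card Idef.card with hm
  have hmd : m ≤ d := (max_le_add_of_nonneg (Nat.zero_le _) (Nat.zero_le _)).trans hdef
  obtain ⟨Rs, hIRs, hRsav, hRscard⟩ :=
    exists_subsuperset_card_eq hIR (le_max_right _ _ : Idef.card ≤ m)
      (max_le hRav_card (card_le_card hIR))
  obtain ⟨Cs, hJCs, hCsav, hCscard⟩ :=
    exists_subsuperset_card_eq hJC (le_max_left _ _ : Jdef.card ≤ m)
      (max_le (card_le_card hJC) hCav_card)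
  -- the swap list
  set Lw : List (Fin n × Fin n) := Rs.toList.zip Cs.toList with hLw
  have hlen1 : Rs.toList.length = m := by rw [length_toList, hRscard]
  have hlen2 : Cs.toList.length = m := by rw [length_toList, hCscard]
  have hfst : Lw.map Prod.fst = Rs.toList := by
    rw [hLw]; exact List.map_fst_zip (by rw [hlen1, hlen2])
  have hsnd : Lw.map Prod.snd = Cs.toList := by
    rw [hLw]; exact List.map_snd_zip (by rw [hlen1, hlen2])
  have h1 : (Lw.map Prod.fst).Nodup := by rw [hfst]; exact nodup_toList _
  have h2 : (Lw.map Prod.snd).Nodup := by rw [hsnd]; exact nodup_toList _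
  have hlen : Lw.length ≤ d := by
    rw [hLw, List.length_zip, hlen1, hlen2, min_self]; exact hmd
  -- hypotheses of `window_after_swaps`
  have hA : ∀ j : Fin n, s ≤ (π (Sum.inr j) : ℕ) → (π (Sum.inr j) : ℕ) < s + L →
      j ∈ Lw.map Prod.snd := by
    intro j hj1 hj2
    rw [hsnd, mem_toList]
    exact hJCs (by rw [hJdef, mem_filter]; exact ⟨mem_univ _, hj1, hj2⟩)
  have hB : ∀ i : Fin n, s + L ≤ (π (Sum.inl i) : ℕ) → (π (Sum.inl i) : ℕ) < s + 2 * L →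
      i ∈ Lw.map Prod.fst := by
    intro i hi1 hi2
    rw [hfst, mem_toList]
    exact hIRs (by rw [hIdef, mem_filter]; exact ⟨mem_univ _, hi1, by omega⟩)
  have hR : ∀ q ∈ Lw, ¬ (s ≤ (π (Sum.inl q.1) : ℕ) ∧ (π (Sum.inl q.1) : ℕ) < s + L) := by
    intro q hq
    have hq1 : q.1 ∈ Rs := by
      have := (List.of_mem_zip (by rw [← hLw]; exact hq)).1
      rwa [mem_toList] at this
    have := hRsav hq1
    rw [hRav, mem_filter] at this
    exact this.2
  have hC : ∀ q ∈ Lw, ¬ (s + L ≤ (π (Sum.inr q.2) : ℕ) ∧ (π (Sum.inr q.2) : ℕ) < s + 2 * L) := by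
    intro q hq
    have hq2 : q.2 ∈ Cs := by
      have := (List.of_mem_zip (by rw [← hLw]; exact hq)).2
      rwa [mem_toList] at this
    have := hCsav hq2
    rw [hCav, mem_filter] at this
    exact fun h => this.2 ⟨h.1, by omega⟩
  obtain ⟨hrow, hcol⟩ := window_after_swaps π Lw h1 h2 s L hA hB hR hC
  -- the repaired cut has an exact aligned window: rank ≥ 4^d W
  have hbig := hL n (Lw.foldr (fun q e => (Equiv.swap (Sum.inl q.1) (Sum.inr q.2)).trans e) π)
    s hs hrow hcol
  -- and its rank is at most 4^{|Lw|} ≤ 4^d times that of `M_π`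
  have hle := rank_swaps_le
    (fun v : Fin (2 * n) → Bool => (((liouville (Nat.ofBits v + 1)) : ℤ) : ℂ)) π Lw
  have h3 : 4 ^ Lw.length ≤ 4 ^ d := Nat.pow_le_pow_right (by norm_num) hlen
  exact Nat.le_of_mul_le_mul_left (hbig.trans (hle.trans (Nat.mul_le_mul_right _ h3)))
    (by positivity)

end Summit.ValiantsHypothesis.ValiantsHypothesis.Theorems.LiouvilleSarnakLiouvilleCutRank.DefectiveWindow

end
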